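import Summits.BirchSwinnertonDyer.Rank1Residual.SmallImageMu.EulerPrimitive
import Summits.BirchSwinnertonDyer.Rank1Residual.SmallImageMu.KatoDivisibility
import Summits.BirchSwinnertonDyer.Rank1Residual.SmallImageMu.TransportByName
import Summits.BirchSwinnertonDyer.Rank1Residual.X10.CoreTheoremAOddPrimeHolds
import Literature.NumberTheory.EllipticCurves.IwasawaSelmerDualProofs
import Literature.NumberTheory.EllipticCurves.Rank1Residual.MuLambdaCarriers
import HarnessLib
import HarnessLib.Audit

/-!
# Kernel edges of the node `EulerPrimitiveOnClassX9` (ES-C2): 19630 ∧ F1 ⟹ ES-C2; ES-C2 ⟹ the core on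
# X9 (kernel theorem); ES-C2 ∧ F1 ⟹ `μ(X₀) = 0` on X9; ES-C2 ∧ F1 ∧ S-W⁺ ∧ BCS (a) ⟹ the cell node
# `KatoDivisibilityOnClassX9`

HONEST FRAMING (cell `bsd-f3-mu`).  THEOREMS ONLY, sorry-free; nothing booked; every statement is
conditional on the open node(s) in its hypotheses and/or on PUBLISHED named facts taken as binders:
`hfine` = F1 `Kato2004.exists_divisibilityInputs_fineQuotient_zeta` (Kato Thm. 12.5 (4) with (12.5.2)),
`hmodP` = modularity, `hBCS` = BCS 2025 Thm 1.1.2 (a); the class-wide support statement S-W⁺ (`-desc` g1;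
it subsumes `-es`'s S-es-2) is the HYPOTHESIS `hS` spelled over the Literature carrier
`Rank1Residual.MuDefectLeFineMuAt` (Kato §17.13 bookkeeping `k ≤ μ(X₀)`, to be proved from F1 by a prover;
never asserted here).  Ported VERBATIM from the planner's
checked `HOME/es/Sketch2.lean` §3 (sha16 98494ff64eca5b0a, rc 0, 0 sorry, std axioms; BC7 CLEAN ×2).

References: [Kato2004Asterisque] Thm. 12.5/12.6 (p. 222), §13.8, Thm. 17.4 (p. 273), §17.13 (pp. 279–280);
[GreenbergVatsal2000] Prop. 3.7; [CoatesSujatha2005] Conj. A; [BurungaleCastellaSkinner2025] Thm. 1.1.2 (a);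
HOME MEMO-es.md gen 1, es/Sketch2.lean.
-/

-- the summit and its single problem are both named `BirchSwinnertonDyer` (registry layout D-0017)
set_option linter.dupNamespace false

noncomputable section

open scoped Classical MatrixGroups ModularForm NumberField
open CongruenceSubgroup WeierstrassCurve Field IsDedekindDomain
open Literature.NumberTheory.GaloisRepresentations
open Literature.NumberTheory.EllipticCurves Literature.NumberTheory.EllipticCurves.ModularForms
open Literature.NumberTheory.EllipticCurves.Kato2004 Literature.NumberTheory.EllipticCurves.Kato2004.EulerSystemValues
open Literature.NumberTheory.EllipticCurves.GreenbergVatsal2000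
open Literature.NumberTheory.EllipticCurves.Rank1Residual (MuAnZeroAt MuAlgZeroAt KatoDivisibilityAt
  MuDefectNonposAt MuDefectLeFineMuAt isTorsion_of_bcs)
open Summit.BirchSwinnertonDyer.BirchSwinnertonDyer.Rank1Residual

namespace Summit.BirchSwinnertonDyer.Rank1Residual.SmallImageMu

/-- **(b1) Item 19630 (`μ^an = 0` on X9) ∧ F1 ⟹ ES-C2** — per pair Kato §17.13 with the Thm. 12.6 span
clause (`exists_isEulerSystemClass_not_mem`) and GV Prop. 3.7; so ES-C2 is implied by the served analytic
crux and its open content sits on the pairs with `μ(L_p) ≥ 1` only.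
[cite: Kato2004Asterisque, Thm. 12.6 (p. 222), §17.13 (pp. 279–280)] [cite: GreenbergVatsal2000, Prop. 3.7] -/
theorem eulerPrimitiveOnClassX9_of_analyticMuZeroOnClassX9
    (hmodP : nonempty_modularParametrizationData)
    (hfine : exists_divisibilityInputs_fineQuotient_zeta) (hA : AnalyticMuZeroOnClassX9) :
    EulerPrimitiveOnClassX9 := by
  intro W _ _ p _ _ _ _ κ γ I hX9 hκ hγ hγ'
  obtain ⟨-, h5, hgood, hap, hirr, -⟩ := id hX9
  have hp2 : p ≠ 2 := by omega
  have hord : IsOrdinaryAt W p := ⟨hgood, hap⟩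
  haveI : NeZero (W.conductorNorm ℤ) := ⟨(W.conductorNorm_pos_holds).ne'⟩
  obtain ⟨Dm⟩ := hmodP W
  have hcert : ∃ n : ℕ, ‖PowerSeries.coeff n (padicLFunction Dm.f (unitRoot W p : ℚ_[p]))‖ = 1 :=
    (analyticMuZeroOnClassX9_iff.mp hA) W p hX9 Dm.f Dm.isNewformOf
  let D : W.SelmerDualData κ γ := W.selmerDualData κ hγ
  obtain ⟨Y⟩ := W.nonempty_fineSelmerDualData κ hγ
  haveI : Module.Finite (IwasawaAlgebra p) D.X :=
    WeierstrassCurve.SelmerDualData.module_finite_of_isCyclotomic W κ hκ D hγ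
  obtain ⟨K, π, hπs, hπ, hZ⟩ := hfine W p Dm.f κ γ hp2 hord hκ hγ hγ' Dm.isNewformOf I D Y
  obtain ⟨G₁, hG₁⟩ := exists_iwasawaToPowerSeries_eq_padicLFunction hp2 hord Dm.isNewformOf hirr
  have hμL : G₁ ∉ IwasawaAlgebra.augIdealP p := not_mem_augIdealP_of_norm_coeff_eq_one hG₁ hcert
  obtain ⟨s, hs, hsp⟩ := exists_isEulerSystemClass_not_mem K hZ hirr hG₁ hμL
  exact ⟨s, hs, hsp⟩

/-- **(b2) ES-C2 ⟹ the core conclusion on X9** (`Sel₀[p]` is killed by a power of `γ − 1`) — by the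
KERNEL theorem `X10.coreTheoremAOddPrime_holds` (the `μ`-transfer core, any odd prime, `Irr ∧ ¬Surj`).
[cite: Kato2004Asterisque, Thm. 12.6 (p. 222) (shape only)] -/
theorem fineCore_of_eulerPrimitiveOnClassX9 (h : EulerPrimitiveOnClassX9) :
    ∀ (W : WeierstrassCurve ℚ) [W.IsElliptic] [W.IsGloballyMinimal] (p : ℕ) [Fact p.Prime]
      [ContinuousSMul ℤ_[p] (W.tateModule p)] [Module.Free ℤ_[p] (W.tateModule p)]
      [Module.Finite ℤ_[p] (W.tateModule p)]
      (κ : ZpExtension ℚ p) (γ : absoluteGaloisGroup ℚ) (I : IwasawaH1Data W p κ γ),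
      ClassX9 W p → κ.IsCyclotomic → κ.IsTopGenerator γ → IsCyclotomicVariable p γ →
      ∃ J : ℕ, ∀ y : Literature.NumberTheory.EllipticCurves.subgroupH1 κ.kerSubgroup
          (WeierstrassCurve.geomTorsion W (p : ℤ)),
        W.torsionToPrimaryH1Sub p κ.kerSubgroup y ∈ W.fineSelmerInfty κ →
          (⇑(Literature.NumberTheory.EllipticCurves.conjH1 κ.kerSubgroup
              (WeierstrassCurve.geomTorsion W (p : ℤ)) γ -
            AddMonoidHom.id (Literature.NumberTheory.EllipticCurves.subgroupH1 κ.kerSubgroup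
              (WeierstrassCurve.geomTorsion W (p : ℤ)))))^[J] y = 0 :=
  fun W _ _ p _ _ _ _ κ γ I hX9 hκ hγ hγ' ↦
    Summit.BirchSwinnertonDyer.Rank1Residual.X10.coreTheoremA_classX9_of_oddPrime
      Summit.BirchSwinnertonDyer.Rank1Residual.X10.coreTheoremAOddPrime_holds W p κ γ I hX9 hκ hγ
      (h W p κ γ I hX9 hκ hγ hγ')

/-- **(b3) ES-C2 ∧ F1 ⟹ `μ(X₀(E/ℚ_∞)) = 0` on X9** for every dual fine Selmer datum (Coates–Sujatha
Conjecture A, `μ`-part, on class X9): the core kills `Sel₀[p]` up to a finite group, so `X₀/pX₀` is finite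
and `length_{(p)} X₀ = 0`.  F1 enters only for `X₀` finitely generated; modularity for a newform.
[cite: Kato2004Asterisque, §17.13 (pp. 279–280)] [cite: CoatesSujatha2005, Conj. A (shape only)] -/
theorem fineMu_eq_zero_of_eulerPrimitiveOnClassX9 (hmodP : nonempty_modularParametrizationData)
    (hfine : exists_divisibilityInputs_fineQuotient_zeta) (h : EulerPrimitiveOnClassX9) :
    ∀ (W : WeierstrassCurve ℚ) [W.IsElliptic] [W.IsGloballyMinimal] (p : ℕ) [Fact p.Prime]
      (κ : ZpExtension ℚ p) (γ : absoluteGaloisGroup ℚ),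
      ClassX9 W p → κ.IsCyclotomic → κ.IsTopGenerator γ → IsCyclotomicVariable p γ →
      ∀ Y : W.FineSelmerDualData κ γ, muInvariant p Y.X = 0 := by
  intro W _ _ p _ κ γ hX9 hκ hγ hγ' Y
  obtain ⟨-, h5, hgood, hap, hirr, -⟩ := id hX9
  have hp2 : p ≠ 2 := by omega
  have hord : IsOrdinaryAt W p := ⟨hgood, hap⟩
  haveI : ContinuousSMul ℤ_[p] (W.tateModule p) := TateModule.continuousSMul_padicInt
  haveI : Module.Free ℤ_[p] (W.tateModule p) := W.module_free_tateModule_holds p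
  haveI : Module.Finite ℤ_[p] (W.tateModule p) := W.module_finite_tateModule_holds p
  haveI : NeZero (W.conductorNorm ℤ) := ⟨(W.conductorNorm_pos_holds).ne'⟩
  obtain ⟨Dm⟩ := hmodP W
  obtain ⟨I⟩ := nonempty_iwasawaH1Data_holds W p κ γ hκ hγ
  let D : W.SelmerDualData κ γ := W.selmerDualData κ hγ
  haveI : Module.Finite (IwasawaAlgebra p) D.X :=
    WeierstrassCurve.SelmerDualData.module_finite_of_isCyclotomic W κ hκ D hγ
  obtain ⟨K, π, hπs, hπ, hZ⟩ := hfine W p Dm.f κ γ hp2 hord hκ hγ hγ' Dm.isNewformOf I D Y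
  haveI : Module.Finite (IwasawaAlgebra p) Y.X := Module.Finite.of_surjective π hπs
  obtain ⟨J, hJ⟩ := fineCore_of_eulerPrimitiveOnClassX9 h W p κ γ I hX9 hκ hγ hγ'
  haveI : Finite (Y.X ⧸ (IwasawaAlgebra.augIdealP p • (⊤ : Submodule (IwasawaAlgebra p) Y.X))) :=
    Y.finite_quotient_augIdealP_of_finite_pTorsion
      (W.finite_fineSelmerInfty_pTorsion_of_forall_iterate_eq_zero κ hγ hJ)
  let 𝔭 : PrimeSpectrum (IwasawaAlgebra p) :=
    ⟨IwasawaAlgebra.augIdealP p, IwasawaAlgebra.isPrime_augIdealP_holds p⟩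
  have hY0 : Module.lengthAt (IwasawaAlgebra p) Y.X 𝔭 = 0 :=
    Summit.BirchSwinnertonDyer.BirchSwinnertonDyer.Rank1Residual.KatoMuSkeleton.lengthAt_eq_zero_of_finite_quotient_p
      (M := Y.X) 𝔭 rfl
  rw [muInvariant_eq_toNat_lengthAt p Y.X 𝔭 rfl, hY0]
  rfl

/-- Torsion passes to quotients (surjective images). [folklore] -/
private theorem isTorsion_of_surjective {R M M' : Type*} [CommRing R] [AddCommGroup M] [Module R M]
    [AddCommGroup M'] [Module R M'] (π : M →ₗ[R] M') (hπ : Function.Surjective π)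
    (hM : Module.IsTorsion R M) : Module.IsTorsion R M' := by
  intro y
  obtain ⟨x, rfl⟩ := hπ y
  obtain ⟨a, ha⟩ := @hM x
  refine ⟨a, ?_⟩
  rw [Submonoid.smul_def, ← map_smul, ← Submonoid.smul_def, ha, map_zero]

/-- **(b4) ES-C2 ∧ F1 ∧ S-W⁺ ∧ BCS (a) ⟹ the `μ`-defect is `≤ 0` at every X9 pair** (`MuDefectNonposAt`),
where S-W⁺ = «`k ≤ μ(X₀)`» at every odd good ordinary irreducible pair is the HYPOTHESIS `hS` over the
Literature carrier `Rank1Residual.MuDefectLeFineMuAt` (Kato §17.13 bookkeeping — a prover's item closed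
from `Kato2004.exists_divisibilityInputs_fineQuotient`, NOT asserted; the cell's S-es-2 «`μ(X₀) = 0 ⟹
k ≤ 0`» is its composite with (b3)).  Per cyclotomic datum the pinned fine datum `Y` is finitely
generated (F1's surjection `X ↠ X₀`) and torsion (a quotient of `X`, torsion by BCS (a) clause 1,
`Rank1Residual.isTorsion_of_bcs`), and has `μ(Y) = 0` by (b3).
[cite: Kato2004Asterisque, Thm. 17.4 (p. 273), §17.13 (pp. 279–280)]
[cite: BurungaleCastellaSkinner2025, Thm. 1.1.2 (a) (p. 2 of arXiv:2405.00270v2)] -/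
theorem muDefectNonposAt_of_eulerPrimitiveOnClassX9 (hmodP : nonempty_modularParametrizationData)
    (hfine : exists_divisibilityInputs_fineQuotient_zeta)
    (hBCS : burungale_castella_skinner_charIdeal_eq_padicLFunction)
    (hS : ∀ (W : WeierstrassCurve ℚ) [W.IsElliptic] [W.IsGloballyMinimal] (p : ℕ) [Fact p.Prime],
      p ≠ 2 → W.HasGoodReductionAtPrime p → ¬ (p : ℤ) ∣ W.frobeniusTrace p →
      W.HasIrreducibleModPGaloisRep p → MuDefectLeFineMuAt W p)
    (h : EulerPrimitiveOnClassX9) {W : WeierstrassCurve ℚ} [W.IsElliptic] [W.IsGloballyMinimal]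
    {p : ℕ} [Fact p.Prime] (hX9 : ClassX9 W p) : MuDefectNonposAt W p := by
  obtain ⟨-, h5, hgood, hap, hirr, -⟩ := id hX9
  have hp2 : p ≠ 2 := by omega
  have hord : IsOrdinaryAt W p := ⟨hgood, hap⟩
  refine (hS W p hp2 hgood hap hirr).muDefectNonposAt_of_exists ?_
  intro κ γ hκ hγ hγ'
  haveI : ContinuousSMul ℤ_[p] (W.tateModule p) := TateModule.continuousSMul_padicInt
  haveI : Module.Free ℤ_[p] (W.tateModule p) := W.module_free_tateModule_holds p
  haveI : Module.Finite ℤ_[p] (W.tateModule p) := W.module_finite_tateModule_holds p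
  haveI : NeZero (W.conductorNorm ℤ) := ⟨(W.conductorNorm_pos_holds).ne'⟩
  obtain ⟨Dm⟩ := hmodP W
  obtain ⟨I⟩ := nonempty_iwasawaH1Data_holds W p κ γ hκ hγ
  let D : W.SelmerDualData κ γ := W.selmerDualData κ hγ
  haveI : Module.Finite (IwasawaAlgebra p) D.X :=
    WeierstrassCurve.SelmerDualData.module_finite_of_isCyclotomic W κ hκ D hγ
  obtain ⟨Y⟩ := W.nonempty_fineSelmerDualData κ hγ
  obtain ⟨K, π, hπs, -, -⟩ := hfine W p Dm.f κ γ hp2 hord hκ hγ hγ' Dm.isNewformOf I D Y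
  have hYf : Module.Finite (IwasawaAlgebra p) Y.X := Module.Finite.of_surjective π hπs
  have hDt : D.IsTorsion := isTorsion_of_bcs hBCS hmodP h5 hgood hap hirr κ γ hκ hγ hγ' D
  have hYt : Module.IsTorsion (IwasawaAlgebra p) Y.X := isTorsion_of_surjective π hπs hDt
  exact ⟨Y, hYf, hYt, fineMu_eq_zero_of_eulerPrimitiveOnClassX9 hmodP hfine h W p κ γ hX9 hκ hγ hγ' Y⟩

/-- **(b4′) ES-C2 ∧ F1 ∧ S-W⁺ ∧ BCS (a) ⟹ the cell node `KatoDivisibilityOnClassX9`** — the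
Euler-system road to the node, per pair through the carrier lemma `MuDefectNonposAt.katoDivisibilityAt`
(BCS (a)) — the reading `katoDivisibilityOnClassX9_iff_muDefectNonpos` of `KatoDivisibilityEdges.lean`,
inlined to keep this file outside the SmallImageMuTransfer route's import cone.
[cite: BurungaleCastellaSkinner2025, Thm. 1.1.2 (a) (p. 2 of arXiv:2405.00270v2)] [cite: Kato2004Asterisque, Thm. 17.4 (p. 273)] -/
theorem katoDivisibilityOnClassX9_of_eulerPrimitiveOnClassX9
    (hmodP : nonempty_modularParametrizationData)
    (hfine : exists_divisibilityInputs_fineQuotient_zeta)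
    (hBCS : burungale_castella_skinner_charIdeal_eq_padicLFunction)
    (hS : ∀ (W : WeierstrassCurve ℚ) [W.IsElliptic] [W.IsGloballyMinimal] (p : ℕ) [Fact p.Prime],
      p ≠ 2 → W.HasGoodReductionAtPrime p → ¬ (p : ℤ) ∣ W.frobeniusTrace p →
      W.HasIrreducibleModPGaloisRep p → MuDefectLeFineMuAt W p)
    (h : EulerPrimitiveOnClassX9) : KatoDivisibilityOnClassX9 := by
  intro W _ _ p _ κ γ N _ f hX9 hκ hγ hγ' hf D
  obtain ⟨-, h5, hgood, hap, hirr, -⟩ := id hX9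
  exact ((muDefectNonposAt_of_eulerPrimitiveOnClassX9 hmodP hfine hBCS hS h hX9).katoDivisibilityAt
    hBCS h5 hgood hap hirr) κ γ f hκ hγ hγ' hf D

end Summit.BirchSwinnertonDyer.Rank1Residual.SmallImageMu

end
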